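import Literature.NumberTheory.EllipticCurves.CongruentNumberCurveRootNumberEven
import Literature.NumberTheory.EllipticCurves.TwistRootNumberModularityProofs
import HarnessLib

/-!
# Koblitz's sign and level table for `E_n : y² = x³ - n²x` in the tree's vocabulary

Koblitz, *Introduction to Elliptic Curves and Modular Forms*, GTM 97, Ch. II §5, Theorem (p. 84)
(quoted from Top–Yui, *Congruent number problems and their variants*, MSRI Publ. 44 (2008), §3,
p. 618): for squarefree `n` the completed `L`-function of `E_n : y² = x³ - n²x` at level
`N = 32 n²` (`n` odd), resp. `16 n²` (`n` even), is entire with functional equation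
`Λ(s) = w Λ(2 - s)`, `w = +1` for `n ≡ 1, 2, 3 (mod 8)` and `w = -1` for `n ≡ 5, 6, 7 (mod 8)`.
The tree proves this by complex multiplication (Hecke characters of `ℚ(i)`), with `Λ` described
through Mathlib's `LSeries` of `WeierstrassCurve.LFunction`:
`congruentNumberCurve_completedL_functional_equation_odd` (`CongruentNumberCurveRootNumber.lean`)
and `congruentNumberCurve_completedL_functional_equation_even`
(`CongruentNumberCurveRootNumberEven.lean`).

This file reads that theorem in the vocabulary the rest of the tree uses for elliptic curves over
`ℚ` — the analytically defined global root number `WeierstrassCurve.rootNumber` (sign of the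
functional equation *at level the conductor* `WeierstrassCurve.conductorNorm ℤ`, `RootNumber.lean`)
and the conductor itself — **without Tate's algorithm**, through the tree's *level lemma*
`WeierstrassCurve.level_eq_and_sign_eq_of_completedLContinuations`
(`TwistRootNumberModularityProofs.lean`): two functional equations for entire continuations of
`M₁^{s/2}(2π)^{-s}Γ(s)L(E,s)` and `M₂^{s/2}(2π)^{-s}Γ(s)L(E,s)` force `M₁ = M₂` and equal signs.

* `mem_completedLContinuations_of_eq_LSeries` — an entire `Λ` agreeing with
  `M^{s/2}(2π)^{-s}Γ(s)·LSeries(E, s)` on `Re s > 3/2` lies in `W.completedLContinuations M`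
  (on that half-plane `W.entireLFunction = W.LSeries` in both branches of its definition).
* `rootNumber_eq_one_of_functional_equation` — **unconditional**: a functional equation with sign
  `+1` at *some* level `M ≠ 0` forces `w(E) = 1` (a continuation at level `N_E` with sign `-1`
  would give `-1 = +1` by the level lemma).
* `rootNumber_eq_and_conductorNorm_eq_of_functional_equation` — modulo the Modularity Theorem
  `exists_isNewformOf` (BCDT 2001, which supplies *a* functional equation at level `N_E`): a
  functional equation with sign `w` at level `M ≠ 0` gives `w(E) = w` and `N_E = M`
  (the tree's `WeierstrassCurve.rootNumber_eq_and_conductorNorm_eq_of_completedLContinuations`).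
* For the congruent number curves (`congruentNumberCurve n = ⟨0, 0, 0, -n², 0⟩`, `n` squarefree):
  `rootNumber_congruentNumberCurve_eq_one_of_mod_eight` — **`w(E_n) = +1` for
  `n ≡ 1, 2, 3 (mod 8)`, unconditionally**; and, modulo `exists_isNewformOf`,
  `conductorNorm_congruentNumberCurve_of_odd` (`N(E_n) = 32 n²`),
  `conductorNorm_congruentNumberCurve_of_even` (`N(E_n) = 16 n²`),
  `rootNumber_congruentNumberCurve_eq_neg_one_of_mod_eight` (`w(E_n) = -1` for
  `n ≡ 5, 6, 7 (mod 8)`), `rootNumber_congruentNumberCurve_eq_one_iff`, and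
  `isSquare_conductorNorm_congruentNumberCurve_of_even` (`N(E_n) = (4n)²` is a perfect square for
  even `n` — the «square level» of the Goldfeld census, on which every imaginary quadratic twist
  prime to `N` reverses the sign, `IwaniecOrderYield.lean`).

Everything is proved; no definitions and no named facts are introduced (D-0026). The only named
fact appearing as a hypothesis is `exists_isNewformOf`, and only where stated.

## References

* [KoblitzECMF1993] N. Koblitz, *Introduction to Elliptic Curves and Modular Forms*, GTM 97,
  2nd ed. (1993), Ch. II §5, Theorem (p. 84). Not held; statement quoted from Top–Yui.
* [TopYui2008Congruent] J. Top, N. Yui, *Congruent number problems and their variants*, MSRI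
  Publ. 44 (2008), §3, p. 618.
* [SilvermanAEC2009] J. H. Silverman, *The Arithmetic of Elliptic Curves*, 2nd ed., App. C §16,
  Thm. C.16.3 (conductor and sign of the functional equation).
* [BCDTJAMS2001] C. Breuil, B. Conrad, F. Diamond, R. Taylor, JAMS 14 (2001), Thm. A.
-/

noncomputable section

open Complex

namespace Literature.NumberTheory.EllipticCurves

open Literature.NumberTheory.EllipticCurves.ModularForms

/-! ### From an `LSeries`-level functional equation to the tree's root number and conductor -/

section General

variable (W : WeierstrassCurve ℚ)

/-- An entire function agreeing with `M^{s/2}(2π)^{-s}Γ(s)·L(W, s)` (`L` = Mathlib's `LSeries` of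
`W.LFunction`) on `Re s > 3/2` is an entire continuation of the tree's raw completed
`L`-function at level `M` (`W.completedLContinuations M`): on that half-plane `W.entireLFunction`
agrees with `W.LSeries` whether or not an entire continuation of `L` exists
(`entireLFunction_eq_LSeries`, resp. the junk branch
`entireLFunction_eq_LSeries_of_not_hasEntireLFunction`); Silverman AEC C.16, the completed
`L`-function `ξ_E(s) = N^{s/2}(2π)^{-s}Γ(s)L_E(s)` (p. 450) and Thm. C.16.3.
[cite: SilvermanAEC2009, App. C §16, Thm. C.16.3] -/
theorem mem_completedLContinuations_of_eq_LSeries {M : ℕ} {Λ : ℂ → ℂ} (hd : Differentiable ℂ Λ)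
    (hv : ∀ s : ℂ, 3 / 2 < s.re →
      Λ s = (M : ℂ) ^ (s / 2) * (2 * Real.pi : ℂ) ^ (-s) * Complex.Gamma s * W.LSeries s) :
    Λ ∈ W.completedLContinuations M := by
  refine ⟨hd, fun s hs ↦ ?_⟩
  have hE : W.entireLFunction s = W.LSeries s := by
    by_cases hW : W.HasEntireLFunction
    · exact W.entireLFunction_eq_LSeries hW hs
    · have hW' : ¬ (W.entireContinuations).Nonempty := hW
      rw [WeierstrassCurve.entireLFunction, dif_neg hW']
  rw [hv s hs, WeierstrassCurve.completedLFunction, hE]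

/-- `Λ(s) = w Λ(2 - s)` for all `s` is the same as `Λ(2 - s) = w Λ(s)` for all `s`. [folklore] -/
private theorem functional_equation_two_sub {Λ : ℂ → ℂ} {w : ℂ} (h : ∀ s : ℂ, Λ s = w * Λ (2 - s))
    (s : ℂ) : Λ (2 - s) = w * Λ s := by
  have := h (2 - s)
  rwa [sub_sub_cancel] at this

/-- **A functional equation with sign `+1` at some level forces `w(E) = +1`, unconditionally.**
If `E / ℚ` is elliptic and some entire `Λ` agrees with `M^{s/2}(2π)^{-s}Γ(s)L(E, s)` on
`Re s > 3/2` (`M ≠ 0`) and satisfies `Λ(s) = Λ(2 - s)`, then the tree's analytic root number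
`W.rootNumber` (the sign of the functional equation at level `N_E`, `+1` by default) is `+1`:
were it `-1`, an entire continuation at level `N_E` with sign `-1` would exist, and the level
lemma (`WeierstrassCurve.level_eq_and_sign_eq_of_completedLContinuations`) would give `1 = -1`.
Silverman AEC Thm. C.16.3 ("*the* sign"). [cite: SilvermanAEC2009, App. C §16, Thm. C.16.3] -/
theorem rootNumber_eq_one_of_functional_equation [W.IsElliptic] {M : ℕ} (hM : M ≠ 0)
    {Λ : ℂ → ℂ} (hd : Differentiable ℂ Λ)
    (hv : ∀ s : ℂ, 3 / 2 < s.re →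
      Λ s = (M : ℂ) ^ (s / 2) * (2 * Real.pi : ℂ) ^ (-s) * Complex.Gamma s * W.LSeries s)
    (hfe : ∀ s : ℂ, Λ s = Λ (2 - s)) : W.rootNumber = 1 := by
  rcases W.rootNumber_eq_one_or with h | h
  · exact h
  · exfalso
    have hFE : W.HasFunctionalEquationSign (-1) := by
      by_contra hne
      rw [WeierstrassCurve.rootNumber, if_neg hne] at h
      norm_num at h
    obtain ⟨Λ', hΛ', hfe'⟩ := hFE
    have hΛ := mem_completedLContinuations_of_eq_LSeries W hd hv
    have h1 : ∀ s : ℂ, Λ (2 - s) = 1 * Λ s :=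
      functional_equation_two_sub (w := 1) (fun s ↦ by rw [one_mul]; exact hfe s)
    have key := W.level_eq_and_sign_eq_of_completedLContinuations hM
      (W.conductorNorm_pos_holds).ne' hΛ h1 hΛ' hfe'
    have := key.2
    push_cast at this
    norm_num at this

/-- **Sign and conductor from a functional equation at some level, modulo Modularity.** Assume
`exists_isNewformOf` (BCDT 2001, Thm. A: it provides a functional equation at level `N_E`). If
`E / ℚ` is elliptic and some entire `Λ` agrees with `M^{s/2}(2π)^{-s}Γ(s)L(E, s)` on `Re s > 3/2`
(`M ≠ 0`) and satisfies `Λ(s) = w Λ(2 - s)` with `w ∈ ℤ`, then `w(E) = w` and `N_E = M` — the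
tree's `WeierstrassCurve.rootNumber_eq_and_conductorNorm_eq_of_completedLContinuations` fed with
`mem_completedLContinuations_of_eq_LSeries`. Silverman AEC Thm. C.16.3.
[cite: SilvermanAEC2009, App. C §16, Thm. C.16.3] [cite: BCDTJAMS2001, Thm. A] -/
theorem rootNumber_eq_and_conductorNorm_eq_of_functional_equation (hmod : exists_isNewformOf)
    [W.IsElliptic] {M : ℕ} (hM : M ≠ 0) {w : ℤ} {Λ : ℂ → ℂ} (hd : Differentiable ℂ Λ)
    (hv : ∀ s : ℂ, 3 / 2 < s.re →
      Λ s = (M : ℂ) ^ (s / 2) * (2 * Real.pi : ℂ) ^ (-s) * Complex.Gamma s * W.LSeries s)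
    (hfe : ∀ s : ℂ, Λ s = w * Λ (2 - s)) : W.rootNumber = w ∧ W.conductorNorm ℤ = M := by
  have hΛ := mem_completedLContinuations_of_eq_LSeries W hd hv
  have key := W.rootNumber_eq_and_conductorNorm_eq_of_completedLContinuations hmod hM hΛ
    (functional_equation_two_sub hfe)
  exact ⟨by exact_mod_cast key.1, key.2⟩

end General

/-! ### The congruent number curves -/

section CongruentNumber

variable {n : ℕ}

/-- A squarefree `n` is `≡ 1, 2, 3, 5, 6, 7 (mod 8)` (`4 ∤ n`). [folklore] -/
private theorem mod_eight_of_squarefree (hsq : Squarefree n) :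
    n % 8 = 1 ∨ n % 8 = 2 ∨ n % 8 = 3 ∨ n % 8 = 5 ∨ n % 8 = 6 ∨ n % 8 = 7 := by
  have h4 : ¬ 4 ∣ n := fun h ↦ by
    have := hsq 2 (by simpa [← mul_assoc] using h)
    norm_num at this
  omega

/-- A squarefree `n ≡ 2 (mod 4)` is `2d` with `d` odd, `Squarefree (2d)`, and
`n % 8 = 2 ↔ d % 4 = 1`, `n % 8 = 6 ↔ d % 4 = 3`. [folklore] -/
private theorem exists_eq_two_mul_of_even (hsq : Squarefree n) (heven : Even n) :
    ∃ d : ℕ, n = 2 * d ∧ d ≠ 0 ∧ (n % 8 = 2 ↔ d % 4 = 1) ∧ (n % 8 = 6 ↔ d % 4 = 3) := by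
  obtain ⟨d, rfl⟩ := heven.two_dvd
  refine ⟨d, rfl, fun h ↦ by simp [h] at hsq, by omega, by omega⟩

/-- **`w(E_n) = +1` for squarefree `n ≡ 1, 3 (mod 8)`, unconditionally** (Koblitz GTM 97,
Ch. II §5, Theorem, p. 84; Top–Yui §3, p. 618): the CM functional equation at level `32 n²`
has sign `χ₋₄(n)χ₈(n) = +1` (`congruentNumberCurve_completedL_functional_equation_odd`,
`χ₄_mul_χ₈_eq_one`), and `rootNumber_eq_one_of_functional_equation`.
[cite: KoblitzECMF1993, Ch. II §5, Theorem (p. 84)] [cite: TopYui2008Congruent, §3, p. 618] -/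
theorem rootNumber_congruentNumberCurve_eq_one_of_odd (hsq : Squarefree n)
    (h8 : n % 8 = 1 ∨ n % 8 = 3) : (congruentNumberCurve n).rootNumber = 1 := by
  haveI : NeZero n := ⟨hsq.ne_zero⟩
  haveI := isElliptic_congruentNumberCurve hsq.ne_zero
  have hodd : Odd n := Nat.odd_iff.mpr (by omega)
  obtain ⟨Λ, hd, hv, hfe⟩ := congruentNumberCurve_completedL_functional_equation_odd hsq hodd
  refine rootNumber_eq_one_of_functional_equation _ (M := 32 * n ^ 2)
    (mul_ne_zero (by norm_num) (pow_ne_zero 2 hsq.ne_zero)) hd hv fun s ↦ ?_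
  rw [hfe s, χ₄_mul_χ₈_eq_one h8, one_mul]

/-- **`w(E_{2d}) = +1` for squarefree `2d` with `d ≡ 1 (mod 4)`, unconditionally** (Koblitz
GTM 97, Ch. II §5, Theorem, p. 84, case `n ≡ 2 (mod 8)`): the CM functional equation at level
`64 d²` has sign `χ₋₄(d) = +1` (`congruentNumberCurve_completedL_functional_equation_even`).
[cite: KoblitzECMF1993, Ch. II §5, Theorem (p. 84)] [cite: TopYui2008Congruent, §3, p. 618] -/
theorem rootNumber_congruentNumberCurve_two_mul_eq_one {d : ℕ} (hsq : Squarefree (2 * d))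
    (hd : d % 4 = 1) : (congruentNumberCurve (2 * d)).rootNumber = 1 := by
  haveI : NeZero d := ⟨fun h ↦ by simp [h] at hsq⟩
  haveI := isElliptic_congruentNumberCurve hsq.ne_zero
  obtain ⟨Λ, hdiff, hv, hfe⟩ := congruentNumberCurve_completedL_functional_equation_even hsq
  have hχ : ((ZMod.χ₄ d : ℤ) : ℂ) = 1 := by
    rw [ZMod.χ₄_nat_eq_if_mod_four, if_neg (by omega), if_pos hd]; simp
  refine rootNumber_eq_one_of_functional_equation _ (M := 64 * d ^ 2)
    (mul_ne_zero (by norm_num) (pow_ne_zero 2 (NeZero.ne d))) hdiff hv fun s ↦ ?_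
  rw [hfe s, hχ, one_mul]

/-- **Koblitz's `+1` half, unconditionally: `w(E_n) = +1` for squarefree `n ≡ 1, 2, 3 (mod 8)`**
(GTM 97, Ch. II §5, Theorem, p. 84; Top–Yui §3, p. 618), for the tree's analytic root number
`WeierstrassCurve.rootNumber`, by complex multiplication and the level lemma — no modularity, no
Tate algorithm. [cite: KoblitzECMF1993, Ch. II §5, Theorem (p. 84)]
[cite: TopYui2008Congruent, §3, p. 618] -/
theorem rootNumber_congruentNumberCurve_eq_one_of_mod_eight (hsq : Squarefree n)
    (h8 : n % 8 = 1 ∨ n % 8 = 2 ∨ n % 8 = 3) : (congruentNumberCurve n).rootNumber = 1 := by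
  rcases h8 with h8 | h8 | h8
  · exact rootNumber_congruentNumberCurve_eq_one_of_odd hsq (Or.inl h8)
  · obtain ⟨d, rfl, -, h2, -⟩ := exists_eq_two_mul_of_even hsq (Nat.even_iff.mpr (by omega))
    exact rootNumber_congruentNumberCurve_two_mul_eq_one hsq (h2.mp h8)
  · exact rootNumber_congruentNumberCurve_eq_one_of_odd hsq (Or.inr h8)

/-- **`N(E_n) = 32 n²` and `w(E_n) = χ₋₄(n)χ₈(n)` for odd squarefree `n`, modulo Modularity**
(Koblitz GTM 97, Ch. II §5, Theorem, p. 84: "`N = 32 n²` for `n` odd"): the conductor is read off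
the CM functional equation by the level lemma; `exists_isNewformOf` only supplies the existence
of a functional equation at level `N_E`. [cite: KoblitzECMF1993, Ch. II §5, Theorem (p. 84)]
[cite: BCDTJAMS2001, Thm. A] -/
theorem rootNumber_eq_and_conductorNorm_congruentNumberCurve_of_odd (hmod : exists_isNewformOf)
    (hsq : Squarefree n) (hodd : Odd n) :
    ((congruentNumberCurve n).rootNumber : ℂ) = ((ZMod.χ₄ n : ℤ) : ℂ) * ((ZMod.χ₈ n : ℤ) : ℂ) ∧
      (congruentNumberCurve n).conductorNorm ℤ = 32 * n ^ 2 := by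
  haveI : NeZero n := ⟨hsq.ne_zero⟩
  haveI := isElliptic_congruentNumberCurve hsq.ne_zero
  obtain ⟨Λ, hd, hv, hfe⟩ := congruentNumberCurve_completedL_functional_equation_odd hsq hodd
  have hΛ := mem_completedLContinuations_of_eq_LSeries _ hd hv
  have key := (congruentNumberCurve n).rootNumber_eq_and_conductorNorm_eq_of_completedLContinuations
    hmod (M := 32 * n ^ 2) (mul_ne_zero (by norm_num) (pow_ne_zero 2 hsq.ne_zero)) hΛ
    (functional_equation_two_sub hfe)
  exact key

/-- **`N(E_n) = 32 n²` for odd squarefree `n`**, modulo `exists_isNewformOf` (Koblitz GTM 97,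
Ch. II §5, Theorem, p. 84). [cite: KoblitzECMF1993, Ch. II §5, Theorem (p. 84)]
[cite: BCDTJAMS2001, Thm. A] -/
theorem conductorNorm_congruentNumberCurve_of_odd (hmod : exists_isNewformOf) (hsq : Squarefree n)
    (hodd : Odd n) : (congruentNumberCurve n).conductorNorm ℤ = 32 * n ^ 2 :=
  (rootNumber_eq_and_conductorNorm_congruentNumberCurve_of_odd hmod hsq hodd).2

/-- **`N(E_{2d}) = 64 d²` and `w(E_{2d}) = χ₋₄(d)` for squarefree `2d`, modulo Modularity**
(Koblitz GTM 97, Ch. II §5, Theorem, p. 84: "`N = 16 n²` for `n` even").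
[cite: KoblitzECMF1993, Ch. II §5, Theorem (p. 84)] [cite: BCDTJAMS2001, Thm. A] -/
theorem rootNumber_eq_and_conductorNorm_congruentNumberCurve_two_mul (hmod : exists_isNewformOf)
    {d : ℕ} (hsq : Squarefree (2 * d)) :
    (congruentNumberCurve (2 * d)).rootNumber = ZMod.χ₄ d ∧
      (congruentNumberCurve (2 * d)).conductorNorm ℤ = 64 * d ^ 2 := by
  haveI : NeZero d := ⟨fun h ↦ by simp [h] at hsq⟩
  haveI := isElliptic_congruentNumberCurve hsq.ne_zero
  obtain ⟨Λ, hdiff, hv, hfe⟩ := congruentNumberCurve_completedL_functional_equation_even hsq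
  exact rootNumber_eq_and_conductorNorm_eq_of_functional_equation _ hmod (M := 64 * d ^ 2)
    (mul_ne_zero (by norm_num) (pow_ne_zero 2 (NeZero.ne d))) hdiff hv hfe

/-- **`N(E_n) = 16 n²` for even squarefree `n`**, modulo `exists_isNewformOf` (Koblitz GTM 97,
Ch. II §5, Theorem, p. 84). [cite: KoblitzECMF1993, Ch. II §5, Theorem (p. 84)]
[cite: BCDTJAMS2001, Thm. A] -/
theorem conductorNorm_congruentNumberCurve_of_even (hmod : exists_isNewformOf)
    (hsq : Squarefree n) (heven : Even n) :
    (congruentNumberCurve n).conductorNorm ℤ = 16 * n ^ 2 := by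
  obtain ⟨d, rfl, -, -, -⟩ := exists_eq_two_mul_of_even hsq heven
  rw [(rootNumber_eq_and_conductorNorm_congruentNumberCurve_two_mul hmod hsq).2]
  ring

/-- **The square level: `N(E_n) = (4n)²` is a perfect square for even squarefree `n`**, modulo
`exists_isNewformOf` — the hypothesis `IsSquare (W.conductorNorm ℤ)` of the Goldfeld census's
target shape `QuadraticFields.le_classNumber_logSq_of_four_le_analyticRank_of_isSquare_conductorNorm`
(`IwaniecOrderYield.lean`: on a square level every imaginary quadratic twist prime to the level
has sign `-w(E)`). [cite: KoblitzECMF1993, Ch. II §5, Theorem (p. 84)] [cite: BCDTJAMS2001, Thm. A] -/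
theorem isSquare_conductorNorm_congruentNumberCurve_of_even (hmod : exists_isNewformOf)
    (hsq : Squarefree n) (heven : Even n) :
    IsSquare ((congruentNumberCurve n).conductorNorm ℤ) :=
  ⟨4 * n, by rw [conductorNorm_congruentNumberCurve_of_even hmod hsq heven]; ring⟩

/-- **Koblitz's `-1` half, modulo Modularity: `w(E_n) = -1` for squarefree
`n ≡ 5, 6, 7 (mod 8)`** (GTM 97, Ch. II §5, Theorem, p. 84; Top–Yui §3, p. 618). Here
`exists_isNewformOf` is needed (for the tree's analytic root number) to know that the functional
equation at level `N_E` exists at all; the sign is then the CM sign `χ₋₄(n)χ₈(n)`, resp.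
`χ₋₄(n/2)`, `= -1`. (The consequence `L(E_n, 1) = 0` is unconditional in the tree:
`entireLFunction_congruentNumberCurve_one_eq_zero_of_mod_eight`.)
[cite: KoblitzECMF1993, Ch. II §5, Theorem (p. 84)] [cite: TopYui2008Congruent, §3, p. 618]
[cite: BCDTJAMS2001, Thm. A] -/
theorem rootNumber_congruentNumberCurve_eq_neg_one_of_mod_eight (hmod : exists_isNewformOf)
    (hsq : Squarefree n) (h8 : n % 8 = 5 ∨ n % 8 = 6 ∨ n % 8 = 7) :
    (congruentNumberCurve n).rootNumber = -1 := by
  rcases h8 with h8 | h8 | h8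
  · have hodd : Odd n := Nat.odd_iff.mpr (by omega)
    have key := (rootNumber_eq_and_conductorNorm_congruentNumberCurve_of_odd hmod hsq hodd).1
    rw [χ₄_mul_χ₈_eq_neg_one (Or.inl h8)] at key
    exact_mod_cast key
  · obtain ⟨d, rfl, -, -, h6⟩ := exists_eq_two_mul_of_even hsq (Nat.even_iff.mpr (by omega))
    rw [(rootNumber_eq_and_conductorNorm_congruentNumberCurve_two_mul hmod hsq).1,
      ZMod.χ₄_nat_eq_if_mod_four, if_neg (by omega), if_neg (by omega)]
  · have hodd : Odd n := Nat.odd_iff.mpr (by omega)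
    have key := (rootNumber_eq_and_conductorNorm_congruentNumberCurve_of_odd hmod hsq hodd).1
    rw [χ₄_mul_χ₈_eq_neg_one (Or.inr h8)] at key
    exact_mod_cast key

/-- **Koblitz's sign table as an equivalence, modulo Modularity**: for squarefree `n`,
`w(E_n) = +1 ↔ n ≡ 1, 2, 3 (mod 8)` (GTM 97, Ch. II §5, Theorem, p. 84; Top–Yui §3, p. 618:
"the order of vanishing of `L(C_n, s)` at `s = 1` is odd precisely when `n ≡ 5, 6, 7 mod 8`").
The direction `←` is unconditional (`rootNumber_congruentNumberCurve_eq_one_of_mod_eight`).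
[cite: KoblitzECMF1993, Ch. II §5, Theorem (p. 84)] [cite: TopYui2008Congruent, §3, p. 618]
[cite: BCDTJAMS2001, Thm. A] -/
theorem rootNumber_congruentNumberCurve_eq_one_iff (hmod : exists_isNewformOf)
    (hsq : Squarefree n) :
    (congruentNumberCurve n).rootNumber = 1 ↔ (n % 8 = 1 ∨ n % 8 = 2 ∨ n % 8 = 3) := by
  refine ⟨fun h ↦ ?_, rootNumber_congruentNumberCurve_eq_one_of_mod_eight hsq⟩
  rcases mod_eight_of_squarefree hsq with h8 | h8 | h8 | h8 | h8 | h8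
  · exact Or.inl h8
  · exact Or.inr (Or.inl h8)
  · exact Or.inr (Or.inr h8)
  all_goals
    have := rootNumber_congruentNumberCurve_eq_neg_one_of_mod_eight hmod hsq (by omega)
    omega

end CongruentNumber

end Literature.NumberTheory.EllipticCurves

end
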